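import Mathlib

/-!
# Solo-blind (K₃) programme — the multiplicity induction behind the finite all-rank criterion for K♭

In block/letter position the Kraft mass of a target is `K(n) = ∑_{C ∈ P} 2^{-|C| - a_C(n)}`, where `P` is
the presence family, the visible block elements are grouped by their *pattern* `π` (the set of `C ∈ P`
they see), `n_π ≥ 1` is the multiplicity of pattern `π`, and `a_C(n) = ∑_{π ∋ C} n_π`.  Conjecture K♭
for such a configuration reads `K(n) - 2^{-(e + ∑_π n_π)} ≤ R` with `e`, `R` depending only on the
letter data.  This file proves the reduction of that inequality, for ALL multiplicity vectors `n ≥ 1`,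
to the two vertex conditions at `n ≡ 1`:

* (V0) `K(1) - 2^{-(e + |Pt|)} ≤ R`;
* (V1) for every pattern `π ∈ Pt`: `∑_{C ∈ P, C ∉ π} 2^{-|C| - a_C(1)} ≤ R`

(`soloBlind_multiplicity_induction`).  The mechanism: raising `n_π` by one halves every term seen by
`π` and the `E`-term, so with `f(n) = K(n) - 2^{-(e+u(n))} - R` and
`g_π(n) = ∑_{C ∉ π} 2^{-|C| - a_C(n)} - R` one has `f(n + e_π) = (f(n) + g_π(n)) / 2`, and `g_π` is
antitone in `n`, so `g_π(n) ≤ g_π(1) ≤ 0` by (V1).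
-/

namespace Summit.MatrixMultiplication.MatrixMultiplication.Theorems

open Finset

variable {α β : Type*} [DecidableEq β]

/-- The block exponent `a_C(n) = ∑_{π ∈ Pt, π sees C} n π` of a representation `C`. -/
def soloBlindPatExp (Pt : Finset β) (sees : β → α → Bool) (n : β → ℕ) (C : α) : ℕ :=
  ∑ π ∈ Pt.filter (fun π => sees π C), n π

/-- The pattern-model Kraft mass `K(n) = ∑_{C ∈ P} 2^{-(sz C + a_C(n))}`. -/
def soloBlindPatMass (P : Finset α) (sz : α → ℕ) (Pt : Finset β) (sees : β → α → Bool)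
    (n : β → ℕ) : ℚ :=
  ∑ C ∈ P, (1 / 2 : ℚ) ^ (sz C + soloBlindPatExp Pt sees n C)

/-- The partial mass not seen by the pattern `π`: `∑_{C ∈ P, ¬ sees π C} 2^{-(sz C + a_C(n))}`. -/
def soloBlindPatRest (P : Finset α) (sz : α → ℕ) (Pt : Finset β) (sees : β → α → Bool)
    (n : β → ℕ) (π : β) : ℚ :=
  ∑ C ∈ P.filter (fun C => sees π C = false), (1 / 2 : ℚ) ^ (sz C + soloBlindPatExp Pt sees n C)

omit [DecidableEq β] in
/-- The block exponent is monotone in the multiplicities. -/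
theorem soloBlind_patExp_mono (Pt : Finset β) (sees : β → α → Bool) {n n' : β → ℕ}
    (h : ∀ π ∈ Pt, n π ≤ n' π) (C : α) :
    soloBlindPatExp Pt sees n C ≤ soloBlindPatExp Pt sees n' C := by
  unfold soloBlindPatExp
  exact Finset.sum_le_sum fun π hπ => h π (Finset.mem_filter.1 hπ).1

/-- Lowering one multiplicity `n π₀ = k + 1 ↦ k` lowers `a_C` by one exactly for the `C` seen by `π₀`. -/
theorem soloBlind_patExp_update (Pt : Finset β) (sees : β → α → Bool) (n : β → ℕ) {π₀ : β}
    (hπ₀ : π₀ ∈ Pt) (k : ℕ) (hk : n π₀ = k + 1) (C : α) :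
    soloBlindPatExp Pt sees n C
      = soloBlindPatExp Pt sees (Function.update n π₀ k) C + (if sees π₀ C then 1 else 0) := by
  unfold soloBlindPatExp
  by_cases hC : sees π₀ C
  · have hmem : π₀ ∈ Pt.filter (fun π => sees π C) := Finset.mem_filter.2 ⟨hπ₀, hC⟩
    rw [← Finset.add_sum_erase _ _ hmem, ← Finset.add_sum_erase _ _ hmem, if_pos hC,
      Function.update_self, hk]
    have hrest : ∑ x ∈ (Pt.filter (fun π => sees π C)).erase π₀, Function.update n π₀ k x
        = ∑ x ∈ (Pt.filter (fun π => sees π C)).erase π₀, n x := by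
      apply Finset.sum_congr rfl
      intro x hx
      rw [Function.update_of_ne (Finset.ne_of_mem_erase hx)]
    rw [hrest]
    ring
  · rw [if_neg hC, add_zero]
    apply Finset.sum_congr rfl
    intro x hx
    have hx' : x ≠ π₀ := by
      rintro rfl
      exact hC (Finset.mem_filter.1 hx).2
    rw [Function.update_of_ne hx']

omit [DecidableEq β] in
/-- The unseen partial mass is antitone in the multiplicities. -/
theorem soloBlind_patRest_anti (P : Finset α) (sz : α → ℕ) (Pt : Finset β) (sees : β → α → Bool)
    {n n' : β → ℕ} (h : ∀ π ∈ Pt, n π ≤ n' π) (π : β) :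
    soloBlindPatRest P sz Pt sees n' π ≤ soloBlindPatRest P sz Pt sees n π := by
  unfold soloBlindPatRest
  apply Finset.sum_le_sum
  intro C _
  apply pow_le_pow_of_le_one (by norm_num) (by norm_num)
  exact Nat.add_le_add_left (soloBlind_patExp_mono Pt sees h C) _

/-- The one-step identity: with `n π₀ = k + 1` and `n' = n[π₀ ↦ k]`,
`K(n) = (K(n') + Rest_{π₀}(n')) / 2`. -/
theorem soloBlind_patMass_update (P : Finset α) (sz : α → ℕ) (Pt : Finset β) (sees : β → α → Bool)
    (n : β → ℕ) {π₀ : β} (hπ₀ : π₀ ∈ Pt) (k : ℕ) (hk : n π₀ = k + 1) :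
    soloBlindPatMass P sz Pt sees n
      = (soloBlindPatMass P sz Pt sees (Function.update n π₀ k)
          + soloBlindPatRest P sz Pt sees (Function.update n π₀ k) π₀) / 2 := by
  unfold soloBlindPatMass soloBlindPatRest
  rw [Finset.sum_filter, ← Finset.sum_add_distrib, Finset.sum_div]
  apply Finset.sum_congr rfl
  intro C _
  rw [soloBlind_patExp_update Pt sees n hπ₀ k hk C]
  by_cases hC : sees π₀ C
  · rw [if_pos hC]
    simp only [hC, Bool.true_eq_false, ite_false, add_zero]
    rw [← add_assoc, pow_succ]
    ring
  · rw [if_neg hC]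
    simp only [hC, ite_true, add_zero]
    ring

/-- **Multiplicity induction.**  The vertex conditions (V0) and (V1) at `n ≡ 1` imply the K♭-type
inequality `K(n) - 2^{-(e + ∑_π n π)} ≤ R` for every multiplicity vector `n ≥ 1` on `Π`. -/
theorem soloBlind_multiplicity_induction (P : Finset α) (sz : α → ℕ) (Pt : Finset β)
    (sees : β → α → Bool) (e : ℕ) (R : ℚ)
    (hV0 : soloBlindPatMass P sz Pt sees (fun _ => 1) - (1 / 2 : ℚ) ^ (e + Pt.card) ≤ R)
    (hV1 : ∀ π ∈ Pt, soloBlindPatRest P sz Pt sees (fun _ => 1) π ≤ R)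
    (n : β → ℕ) (hn : ∀ π ∈ Pt, 1 ≤ n π) :
    soloBlindPatMass P sz Pt sees n - (1 / 2 : ℚ) ^ (e + ∑ π ∈ Pt, n π) ≤ R := by
  -- induction on the total excess `N = ∑_{π ∈ Pt} n π`
  suffices H : ∀ N : ℕ, ∀ n : β → ℕ, (∀ π ∈ Pt, 1 ≤ n π) → ∑ π ∈ Pt, n π = N →
      soloBlindPatMass P sz Pt sees n - (1 / 2 : ℚ) ^ (e + ∑ π ∈ Pt, n π) ≤ R from
    H _ n hn rfl
  intro N
  induction N using Nat.strong_induction_on with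
  | _ N ih =>
    intro n hn hN
    by_cases hall : ∀ π ∈ Pt, n π = 1
    · -- all multiplicities are one: this is (V0)
      have hmass : soloBlindPatMass P sz Pt sees n = soloBlindPatMass P sz Pt sees (fun _ => 1) := by
        unfold soloBlindPatMass soloBlindPatExp
        apply Finset.sum_congr rfl
        intro C _
        congr 2
        exact Finset.sum_congr rfl fun π hπ => hall π (Finset.mem_filter.1 hπ).1
      have hsum : ∑ π ∈ Pt, n π = Pt.card := by
        rw [Finset.card_eq_sum_ones]
        exact Finset.sum_congr rfl hall
      rw [hmass, hsum]
      exact hV0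
    · push Not at hall
      obtain ⟨π₀, hπ₀, hne⟩ := hall
      have h2 : 2 ≤ n π₀ := by
        have := hn π₀ hπ₀
        omega
      obtain ⟨k, hk⟩ : ∃ k, n π₀ = k + 1 := ⟨n π₀ - 1, by omega⟩
      have hk1 : 1 ≤ k := by omega
      set n' := Function.update n π₀ k with hn'
      have hn'le : ∀ π ∈ Pt, n' π ≤ n π := by
        intro π _
        by_cases hπ : π = π₀
        · subst hπ
          rw [hn', Function.update_self]
          omega
        · rw [hn', Function.update_of_ne hπ]
      have hn'1 : ∀ π ∈ Pt, 1 ≤ n' π := by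
        intro π hπ
        by_cases hππ : π = π₀
        · subst hππ
          rw [hn', Function.update_self]
          exact hk1
        · rw [hn', Function.update_of_ne hππ]
          exact hn π hπ
      have hsum : ∑ π ∈ Pt, n π = ∑ π ∈ Pt, n' π + 1 := by
        rw [← Finset.add_sum_erase _ _ hπ₀, ← Finset.add_sum_erase _ _ hπ₀, hn',
          Function.update_self, hk]
        have : ∑ x ∈ Pt.erase π₀, Function.update n π₀ k x = ∑ x ∈ Pt.erase π₀, n x :=
          Finset.sum_congr rfl fun x hx => by rw [Function.update_of_ne (Finset.ne_of_mem_erase hx)]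
        rw [this]
        ring
      have hlt : ∑ π ∈ Pt, n' π < N := by omega
      have IH := ih _ hlt n' hn'1 rfl
      have hone : ∀ π ∈ Pt, (fun _ : β => 1) π ≤ n' π := fun π hπ => hn'1 π hπ
      have hrest : soloBlindPatRest P sz Pt sees n' π₀ ≤ R :=
        (soloBlind_patRest_anti P sz Pt sees hone π₀).trans (hV1 π₀ hπ₀)
      rw [soloBlind_patMass_update P sz Pt sees n hπ₀ k hk, hsum, ← add_assoc, pow_succ]
      rw [← hn']
      linarith

end Summit.MatrixMultiplication.MatrixMultiplication.Theorems
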